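import Mathlib
import Literature.Geometry.Symplectic.StandardEnd

/-!
# Stub `stub_chartOfAnchors` of line `Sketch` for crux `TameOrBrodyR4` (stmt-SmoothPoincare4-7826, route SullivanDual)

**Anchor maps package into a pencil chart** (the elementary step between the deep stub
`stub_anchorsOrCurve` and the landed stubs `stub_chartTames`, `stub_gluing` of the skeleton
`Cruxes/TameOrBrodyR4/Lines/Sketch.lean`). On `ℝ⁴ = ℂ_z × ℂ_w` (`z = x₀ + i x₁`, `w = x₂ + i x₃`)
let `J` be almost complex, standard (`⟪J a, b⟫ = ω₀(a, b)`, so `J a = (-a₁, a₀, -a₃, a₂)`) on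
`‖x‖ ≥ R`, and let `b, c : ℝ⁴ → ℂ` be the anchor maps of the two complete pencils: smooth
submersions with `J`-invariant, mutually transverse kernels, `c = z` where `|z| ≥ R`, `b = w`
where `|w| ≥ R`, `d(b - w), d(c - z) → 0` at infinity, `b - w`, `c - z` bounded. The pencil
chart is `Φ = (Re c, Im c, Re b, Im b)`, `DΦ v = (Re dc v, Im dc v, Re db v, Im db v)`:

* `Φ` is `C^∞`; `DΦ_x` is injective (`DΦ v = 0 ⇒ db v = dc v = 0 ⇒ v = 0`), hence bijective;
  the planes `DΦ⁻¹{y₂ = y₃ = 0} = ker db`, `DΦ⁻¹{y₀ = y₁ = 0} = ker dc` are `J`-invariant;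
* positivity: for `v ≠ 0` in `ker db`, `ω₀(DΦ v, DΦ Jv) = Re(dc v) Im(dc Jv) - Im(dc v) Re(dc Jv)`,
  the *rotation number* `q_x(v)` of `γ = dc_x` (symmetrically `db` on `ker dc`). For `ℝ`-linear
  `γ : ℝ⁴ → ℂ` with `T`-invariant kernel, `T² = -1`, `q(v) ≠ 0` whenever `γ v ≠ 0` (else
  `γ T v = t γ v`, `u = T v - t v ∈ ker γ`, `T u = -v - t T v ∈ ker γ`, `(1 + t²) γ v = 0`);
  `{γ v ≠ 0}` is the complement of a codimension-two subspace, hence connected, so `q` has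
  constant sign there; `{x | q_x > 0}` is open and closed (test one `v`; `dc`, `J` continuous),
  `ℝ⁴` is connected, and at the honest far point `x₀ = (|R|+1, 0, |R|+1, 0)`: `dc = dz`, `J = J₀`,
  `q_{x₀}(v) = v₀² + v₁² > 0`;
* `‖DΦ_x - id‖ ≤ ‖d(c - z)_x‖ + ‖d(b - w)_x‖ → 0` and `‖Φ x - x‖ ≤ ‖c - z‖ + ‖b - w‖ ≤ 2C`.

References: M. Gromov, *Pseudo holomorphic curves in symplectic manifolds*, Invent. Math. 82
(1985), §2.4.A; D. McDuff, D. Salamon, *J-holomorphic curves and symplectic topology*, 2nd ed.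
(2012), §9.4. The proof below is self-contained linear algebra and point-set topology.
-/

open scoped ContDiff Topology InnerProductSpace
open Filter Set Literature.Geometry.Symplectic

-- the registered namespace `Summit.SmoothPoincare4.SmoothPoincare4.…` repeats a component
set_option linter.dupNamespace false

namespace Summit.SmoothPoincare4.SmoothPoincare4.Cruxes.TameOrBrodyR4.Sketch.ChartOfAnchors

/-- The coordinate pair `y ↦ y_i + i y_j` of `ℝ⁴` is a continuous `ℝ`-linear map to `ℂ`. -/
theorem exists_clm_mk (i j : Fin 4) :
    ∃ Z : EuclideanSpace ℝ (Fin 4) →L[ℝ] ℂ, ∀ y, Z y = Complex.mk (y i) (y j) :=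
  ⟨LinearMap.toContinuousLinearMap
    { toFun := fun y => Complex.mk (y i) (y j)
      map_add' := fun y y' => Complex.ext (by simp) (by simp)
      map_smul' := fun s y => Complex.ext (by simp) (by simp) }, fun _ => rfl⟩

/-- The assembling map `(p, r) ↦ (Re p, Im p, Re r, Im r)` from `ℂ × ℂ` to `ℝ⁴` is a continuous
`ℝ`-linear map. -/
theorem exists_clm_chart :
    ∃ L : ℂ × ℂ →L[ℝ] EuclideanSpace ℝ (Fin 4),
      ∀ p r : ℂ, L (p, r) = WithLp.toLp 2 ![p.re, p.im, r.re, r.im] :=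
  ⟨LinearMap.toContinuousLinearMap
    { toFun := fun pr => WithLp.toLp 2 ![pr.1.re, pr.1.im, pr.2.re, pr.2.im]
      map_add' := by intro a a'; ext i; fin_cases i <;> simp
      map_smul' := by intro s a; ext i; fin_cases i <;> simp }, fun _ _ => rfl⟩

/-- `‖(Re p, Im p, Re r, Im r) - y‖ ≤ ‖p - (y₀ + i y₁)‖ + ‖r - (y₂ + i y₃)‖`. -/
theorem norm_toLp_sub_le (p r : ℂ) (y : EuclideanSpace ℝ (Fin 4)) :
    ‖(WithLp.toLp 2 ![p.re, p.im, r.re, r.im] : EuclideanSpace ℝ (Fin 4)) - y‖ ≤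
      ‖p - Complex.mk (y 0) (y 1)‖ + ‖r - Complex.mk (y 2) (y 3)‖ := by
  set p' := p - Complex.mk (y 0) (y 1)
  set r' := r - Complex.mk (y 2) (y 3)
  have h : ‖(WithLp.toLp 2 ![p.re, p.im, r.re, r.im] : EuclideanSpace ℝ (Fin 4)) - y‖ ^ 2
      = ‖p'‖ ^ 2 + ‖r'‖ ^ 2 := by
    rw [EuclideanSpace.real_norm_sq_eq, Fin.sum_univ_four, Complex.sq_norm, Complex.sq_norm,
      Complex.normSq_apply, Complex.normSq_apply]
    simp [p', r']
    ring
  nlinarith [norm_nonneg p', norm_nonneg r', mul_nonneg (norm_nonneg p') (norm_nonneg r'),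
    norm_nonneg ((WithLp.toLp 2 ![p.re, p.im, r.re, r.im] : EuclideanSpace ℝ (Fin 4)) - y)]

/-- `ω₀` of two assembled vectors: the two cross products, no cross terms. -/
theorem stdSymplecticForm_toLp (p r p' r' : ℂ) :
    stdSymplecticForm (WithLp.toLp 2 ![p.re, p.im, r.re, r.im])
      (WithLp.toLp 2 ![p'.re, p'.im, r'.re, r'.im]) =
      p.re * p'.im - p.im * p'.re + r.re * r'.im - r.im * r'.re := by
  simp [stdSymplecticForm]

/-- `d(f - (y_i + i y_j))_x = df_x - Z` for the coordinate map `Z y = y_i + i y_j`. -/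
theorem fderiv_sub_mk {f : EuclideanSpace ℝ (Fin 4) → ℂ} (hf : Differentiable ℝ f)
    (Z : EuclideanSpace ℝ (Fin 4) →L[ℝ] ℂ) (i j : Fin 4) (hZ : ∀ y, Z y = Complex.mk (y i) (y j))
    (x : EuclideanSpace ℝ (Fin 4)) :
    fderiv ℝ (fun y : EuclideanSpace ℝ (Fin 4) => f y - Complex.mk (y i) (y j)) x
      = fderiv ℝ f x - Z := by
  have e : (fun y : EuclideanSpace ℝ (Fin 4) => f y - Complex.mk (y i) (y j)) = fun y => f y - Z y :=
    funext fun y => by rw [hZ]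
  rw [e, fderiv_fun_sub (hf x) Z.differentiableAt, ContinuousLinearMap.fderiv]

/-- At a point where `J` is standard (`⟪J a, b⟫ = ω₀(a, b)`), `J a = (-a₁, a₀, -a₃, a₂)`. -/
theorem apply_of_inner_eq {Jx : EuclideanSpace ℝ (Fin 4) →L[ℝ] EuclideanSpace ℝ (Fin 4)}
    (h : ∀ a b : EuclideanSpace ℝ (Fin 4), ⟪Jx a, b⟫_ℝ = stdSymplecticForm a b)
    (a : EuclideanSpace ℝ (Fin 4)) :
    Jx a 0 = -a 1 ∧ Jx a 1 = a 0 ∧ Jx a 2 = -a 3 ∧ Jx a 3 = a 2 := by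
  have key : ∀ i : Fin 4, Jx a i = stdSymplecticForm a (EuclideanSpace.single i 1) := by
    intro i
    rw [← h a, EuclideanSpace.inner_single_right]
    simp
  refine ⟨?_, ?_, ?_, ?_⟩ <;> rw [key] <;> simp [stdSymplecticForm]

/-! ### Pointwise linear algebra of the rotation number `q(v) = Re(γv)·Im(γJv) - Im(γv)·Re(γJv)` -/

/-- **No real eigen-directions.** Let `γ : ℝ⁴ → ℂ` be `ℝ`-linear with a `T`-invariant kernel,
`T² = -1`. If `γ v ≠ 0` then `γ v` and `γ (T v)` are not real-collinear, i.e. the cross product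
`Re(γ v) Im(γ T v) - Im(γ v) Re(γ T v)` is non-zero: otherwise `γ (T v) = t γ v` for a real `t`,
`u := T v - t v ∈ ker γ`, so `T u = -v - t T v ∈ ker γ`, i.e. `(1 + t²) γ v = 0`. -/
theorem cross_ne_zero (γ : EuclideanSpace ℝ (Fin 4) →L[ℝ] ℂ)
    (T : EuclideanSpace ℝ (Fin 4) →L[ℝ] EuclideanSpace ℝ (Fin 4))
    (hT : ∀ v, T (T v) = -v) (hinv : ∀ v, γ v = 0 → γ (T v) = 0)
    (v : EuclideanSpace ℝ (Fin 4)) (hv : γ v ≠ 0) :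
    (γ v).re * (γ (T v)).im - (γ v).im * (γ (T v)).re ≠ 0 := by
  intro h
  set p := γ v with hp
  set r := γ (T v) with hr
  -- `u := |p|² T v - ⟨p, r⟩ v` lies in the kernel
  have hu : γ (((p.re ^ 2 + p.im ^ 2) • T v) - (p.re * r.re + p.im * r.im) • v) = 0 := by
    rw [map_sub, map_smul, map_smul, ← hp, ← hr]
    apply Complex.ext
    · simp only [Complex.sub_re, Complex.real_smul, Complex.mul_re, Complex.ofReal_re,
        Complex.ofReal_im, zero_mul, sub_zero, Complex.zero_re]
      linear_combination (-p.im) * h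
    · simp only [Complex.sub_im, Complex.real_smul, Complex.mul_im, Complex.ofReal_re,
        Complex.ofReal_im, zero_mul, add_zero, Complex.zero_im]
      linear_combination p.re * h
  have hTu := hinv _ hu
  rw [map_sub, map_smul, map_smul, hT, map_sub, map_smul, map_smul, map_neg, ← hp, ← hr] at hTu
  have hre := congrArg Complex.re hTu
  have him := congrArg Complex.im hTu
  simp only [Complex.sub_re, Complex.sub_im, Complex.real_smul, Complex.mul_re, Complex.mul_im,
    Complex.ofReal_re, Complex.ofReal_im, zero_mul, sub_zero, add_zero, Complex.neg_re,
    Complex.neg_im, Complex.zero_re, Complex.zero_im] at hre him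
  have hN : (p.re ^ 2 + p.im ^ 2) ^ 2 + (p.re * r.re + p.im * r.im) ^ 2 = 0 := by
    linear_combination (-p.re) * hre + (-p.im) * him
  have hN' : p.re ^ 2 + p.im ^ 2 = 0 := by
    nlinarith [sq_nonneg (p.re ^ 2 + p.im ^ 2), sq_nonneg (p.re * r.re + p.im * r.im)]
  have hre0 : p.re = 0 := by nlinarith [sq_nonneg p.re, sq_nonneg p.im]
  have him0 : p.im = 0 := by nlinarith [sq_nonneg p.re, sq_nonneg p.im]
  exact hv (Complex.ext (by rw [hre0, Complex.zero_re]) (by rw [him0, Complex.zero_im]))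

/-- **Constant sign in `v`.** With `γ` moreover surjective, `{v | γ v ≠ 0}` is the complement of
the codimension-two subspace `ker γ`, hence connected; the cross product is continuous and
non-vanishing there (`cross_ne_zero`), so it is positive everywhere on it as soon as it is
positive at one such `v₀`. -/
theorem cross_pos_of_pos_at (γ : EuclideanSpace ℝ (Fin 4) →L[ℝ] ℂ)
    (T : EuclideanSpace ℝ (Fin 4) →L[ℝ] EuclideanSpace ℝ (Fin 4))
    (hT : ∀ v, T (T v) = -v) (hinv : ∀ v, γ v = 0 → γ (T v) = 0)
    (hs : Function.Surjective γ) (v₀ : EuclideanSpace ℝ (Fin 4)) (hv₀ : γ v₀ ≠ 0)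
    (h₀ : 0 < (γ v₀).re * (γ (T v₀)).im - (γ v₀).im * (γ (T v₀)).re)
    (v : EuclideanSpace ℝ (Fin 4)) (hv : γ v ≠ 0) :
    0 < (γ v).re * (γ (T v)).im - (γ v).im * (γ (T v)).re := by
  set K := LinearMap.ker (γ : EuclideanSpace ℝ (Fin 4) →ₗ[ℝ] ℂ) with hK
  have hrank : 1 < Module.rank ℝ (EuclideanSpace ℝ (Fin 4) ⧸ K) := by
    rw [((γ : EuclideanSpace ℝ (Fin 4) →ₗ[ℝ] ℂ).quotKerEquivOfSurjective hs).rank_eq,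
      Complex.rank_real_complex]
    exact Cardinal.one_lt_two
  have hconn : IsPreconnected ((K : Set (EuclideanSpace ℝ (Fin 4)))ᶜ) :=
    (isConnected_compl_of_one_lt_codim hrank).isPreconnected
  have hcont : Continuous fun w : EuclideanSpace ℝ (Fin 4) =>
      (γ w).re * (γ (T w)).im - (γ w).im * (γ (T w)).re := by
    fun_prop
  have hmem : ∀ w, w ∈ (K : Set (EuclideanSpace ℝ (Fin 4)))ᶜ ↔ γ w ≠ 0 := fun w => by
    simp [hK]
  by_contra hneg
  obtain ⟨w, hw, hw0⟩ := hconn.intermediate_value₂ ((hmem v).2 hv) ((hmem v₀).2 hv₀)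
    hcont.continuousOn continuousOn_const (not_lt.1 hneg) h₀.le
  exact cross_ne_zero γ T hT hinv w ((hmem w).1 hw) hw0

/-- **Global positivity from one point.** Let `γ : ℝ⁴ → (ℝ⁴ →L ℂ)` (a derivative `dc`) and `J`
be continuous, `J² = -1`, each `γ x` surjective with `J x`-invariant kernel. If at one point `x₀`
the rotation number `q_{x₀}(v) = Re(γv) Im(γJv) - Im(γv) Re(γJv)` is positive for all `v` with
`γ x₀ v ≠ 0`, then `q_x(v) > 0` for all `x` and all `v` with `γ x v ≠ 0`: the set of good `x`
is open (test one `v`, continuity in `x`, then `cross_pos_of_pos_at`), so is its complement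
(by `cross_ne_zero` a bad `x` has some `q_x(v) < 0`), and `ℝ⁴` is connected. -/
theorem cross_pos_of_pos_at_point
    (γ : EuclideanSpace ℝ (Fin 4) → EuclideanSpace ℝ (Fin 4) →L[ℝ] ℂ)
    (J : EuclideanSpace ℝ (Fin 4) → EuclideanSpace ℝ (Fin 4) →L[ℝ] EuclideanSpace ℝ (Fin 4))
    (hγ : Continuous γ) (hJ : Continuous J) (hJ2 : ∀ x v, J x (J x v) = -v)
    (hs : ∀ x, Function.Surjective (γ x)) (hinv : ∀ x v, γ x v = 0 → γ x (J x v) = 0)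
    (x₀ : EuclideanSpace ℝ (Fin 4))
    (h₀ : ∀ v, γ x₀ v ≠ 0 →
      0 < (γ x₀ v).re * (γ x₀ (J x₀ v)).im - (γ x₀ v).im * (γ x₀ (J x₀ v)).re)
    (x v : EuclideanSpace ℝ (Fin 4)) (hv : γ x v ≠ 0) :
    0 < (γ x v).re * (γ x (J x v)).im - (γ x v).im * (γ x (J x v)).re := by
  set P : Set (EuclideanSpace ℝ (Fin 4)) := {y | ∀ w, γ y w ≠ 0 →
    0 < (γ y w).re * (γ y (J y w)).im - (γ y w).im * (γ y (J y w)).re} with hP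
  suffices hPu : P = univ by
    have hx : x ∈ P := hPu ▸ mem_univ x
    exact hx v hv
  have hcq : ∀ w, Continuous fun y =>
      (γ y w).re * (γ y (J y w)).im - (γ y w).im * (γ y (J y w)).re := by
    intro w; fun_prop
  have hcγ : ∀ w, Continuous fun y => γ y w := by
    intro w; fun_prop
  have hopen : IsOpen P := by
    rw [isOpen_iff_mem_nhds]
    intro y hy
    obtain ⟨w, hw⟩ := hs y 1
    have hw' : γ y w ≠ 0 := by rw [hw]; exact one_ne_zero
    filter_upwards [(hcγ w).continuousAt.eventually_ne hw',
      ((hcq w).continuousAt.tendsto).eventually_const_lt (hy w hw')] with z hz1 hz2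
    exact fun u hu =>
      cross_pos_of_pos_at (γ z) (J z) (hJ2 z) (hinv z) (hs z) w hz1 hz2 u hu
  have hclosed : IsClosed P := by
    rw [← isOpen_compl_iff, isOpen_iff_mem_nhds]
    intro y hy
    obtain ⟨w, hw, hq⟩ : ∃ w, γ y w ≠ 0 ∧
        ¬ 0 < (γ y w).re * (γ y (J y w)).im - (γ y w).im * (γ y (J y w)).re := by
      by_contra hall
      push Not at hall
      exact hy fun w hw => hall w hw
    have hq' : (γ y w).re * (γ y (J y w)).im - (γ y w).im * (γ y (J y w)).re < 0 :=
      lt_of_le_of_ne (not_lt.1 hq) (cross_ne_zero (γ y) (J y) (hJ2 y) (hinv y) w hw)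
    filter_upwards [(hcγ w).continuousAt.eventually_ne hw,
      ((hcq w).continuousAt.tendsto).eventually_lt_const hq'] with z hz1 hz2
    exact fun hz => absurd (hz w hz1) (not_lt.2 hz2.le)
  exact IsClopen.eq_univ ⟨hclosed, hopen⟩ ⟨x₀, h₀⟩

/-! ### The rotation number at an honest far point -/

/-- **Positivity at an honest point.** If `f = y ↦ y_i + i y_j` (the linear map `Z`) on the open
set `{R < |y_i + i y_j|}` containing `x₀`, then `df_{x₀} = Z`, and if `J x₀` rotates the
`(i, j)`-plane positively (`(J a)_i = -a_j`, `(J a)_j = a_i`, as `J₀` does), the rotation number of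
`df_{x₀}` is `v_i² + v_j² > 0` whenever `df_{x₀} v ≠ 0`. -/
theorem cross_pos_at_far_point (f : EuclideanSpace ℝ (Fin 4) → ℂ)
    (Z : EuclideanSpace ℝ (Fin 4) →L[ℝ] ℂ) (i j : Fin 4) (hZ : ∀ y, Z y = Complex.mk (y i) (y j))
    (R : ℝ) (hf : ∀ x : EuclideanSpace ℝ (Fin 4),
      R ≤ ‖(Complex.mk (x i) (x j))‖ → f x = Complex.mk (x i) (x j))
    (Jx : EuclideanSpace ℝ (Fin 4) →L[ℝ] EuclideanSpace ℝ (Fin 4))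
    (hJi : ∀ a, Jx a i = -a j) (hJj : ∀ a, Jx a j = a i)
    (x₀ : EuclideanSpace ℝ (Fin 4)) (hx₀ : R < ‖Z x₀‖) (v : EuclideanSpace ℝ (Fin 4))
    (hv : fderiv ℝ f x₀ v ≠ 0) :
    0 < (fderiv ℝ f x₀ v).re * (fderiv ℝ f x₀ (Jx v)).im
      - (fderiv ℝ f x₀ v).im * (fderiv ℝ f x₀ (Jx v)).re := by
  have hU : IsOpen {y : EuclideanSpace ℝ (Fin 4) | R < ‖Z y‖} :=
    isOpen_lt continuous_const (continuous_norm.comp Z.continuous)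
  have heq : f =ᶠ[𝓝 x₀] Z := by
    filter_upwards [hU.mem_nhds hx₀] with y hy
    have hy' : R ≤ ‖(Complex.mk (y i) (y j))‖ := by rw [← hZ]; exact le_of_lt hy
    rw [hf y hy', hZ]
  have hfd : fderiv ℝ f x₀ = Z := by rw [heq.fderiv_eq, ContinuousLinearMap.fderiv]
  rw [hfd] at hv ⊢
  rw [hZ, hZ, hJi, hJj]
  have hv' : v i ≠ 0 ∨ v j ≠ 0 := by
    by_contra hboth
    push Not at hboth
    exact hv (by rw [hZ, hboth.1, hboth.2]; rfl)
  rcases hv' with h | h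
  · nlinarith [mul_self_pos.2 h, mul_self_nonneg (v j)]
  · nlinarith [mul_self_pos.2 h, mul_self_nonneg (v i)]

end Summit.SmoothPoincare4.SmoothPoincare4.Cruxes.TameOrBrodyR4.Sketch.ChartOfAnchors

namespace Summit.SmoothPoincare4.SmoothPoincare4.Cruxes.TameOrBrodyR4.Sketch

/-- **Registered stub `stub_chartOfAnchors` of line `Sketch`, crux `TameOrBrodyR4`: anchor maps
package into a pencil chart.** For anchor maps `b, c` as delivered by `stub_anchorsOrCurve`, the
pencil chart `Φ = (Re c, Im c, Re b, Im b)` is `C^∞` with bijective derivative, the planes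
`ker db = DΦ⁻¹ L`, `ker dc = DΦ⁻¹ H` are `J`-invariant with `ω₀(DΦ v, DΦ J v) > 0` on them (the
rotation numbers of `dc`, `db` are positive: non-vanishing by `J`-invariance, locally constant
sign, positive at an honest far point, `ℝ⁴` connected), `‖DΦ - id‖ → 0` and `Φ - id` bounded. -/
theorem stub_chartOfAnchors
    (J : EuclideanSpace ℝ (Fin 4) → EuclideanSpace ℝ (Fin 4) →L[ℝ] EuclideanSpace ℝ (Fin 4))
    (R : ℝ) (hJs : ContDiff ℝ ∞ J) (hJ2 : ∀ x v, J x (J x v) = -v)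
    (hJi : ∀ x : EuclideanSpace ℝ (Fin 4), R ≤ ‖x‖ →
      ∀ a b : EuclideanSpace ℝ (Fin 4), ⟪J x a, b⟫_ℝ = stdSymplecticForm a b)
    (b c : EuclideanSpace ℝ (Fin 4) → ℂ) (hb : ContDiff ℝ ∞ b) (hc : ContDiff ℝ ∞ c)
    (hbs : ∀ x, Function.Surjective (fderiv ℝ b x))
    (hcs : ∀ x, Function.Surjective (fderiv ℝ c x))
    (hbJ : ∀ x v, fderiv ℝ b x v = 0 → fderiv ℝ b x (J x v) = 0)
    (hcJ : ∀ x v, fderiv ℝ c x v = 0 → fderiv ℝ c x (J x v) = 0)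
    (htr : ∀ x v, fderiv ℝ b x v = 0 → fderiv ℝ c x v = 0 → v = 0)
    (hch : ∀ x : EuclideanSpace ℝ (Fin 4),
      R ≤ ‖(Complex.mk (x 0) (x 1))‖ → c x = Complex.mk (x 0) (x 1))
    (hbh : ∀ x : EuclideanSpace ℝ (Fin 4),
      R ≤ ‖(Complex.mk (x 2) (x 3))‖ → b x = Complex.mk (x 2) (x 3))
    (hbD : Tendsto (fun x => ‖fderiv ℝ (fun y : EuclideanSpace ℝ (Fin 4) =>
      b y - Complex.mk (y 2) (y 3)) x‖) (cocompact (EuclideanSpace ℝ (Fin 4))) (𝓝 0))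
    (hcD : Tendsto (fun x => ‖fderiv ℝ (fun y : EuclideanSpace ℝ (Fin 4) =>
      c y - Complex.mk (y 0) (y 1)) x‖) (cocompact (EuclideanSpace ℝ (Fin 4))) (𝓝 0))
    (hC : ∃ C : ℝ, ∀ x : EuclideanSpace ℝ (Fin 4),
      ‖b x - Complex.mk (x 2) (x 3)‖ ≤ C ∧ ‖c x - Complex.mk (x 0) (x 1)‖ ≤ C) :
    ∃ Φ : EuclideanSpace ℝ (Fin 4) → EuclideanSpace ℝ (Fin 4), ContDiff ℝ ∞ Φ ∧
      (∀ x, Function.Bijective (fderiv ℝ Φ x)) ∧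
      (∀ x v, fderiv ℝ Φ x v 2 = 0 → fderiv ℝ Φ x v 3 = 0 →
        fderiv ℝ Φ x (J x v) 2 = 0 ∧ fderiv ℝ Φ x (J x v) 3 = 0) ∧
      (∀ x v, fderiv ℝ Φ x v 0 = 0 → fderiv ℝ Φ x v 1 = 0 →
        fderiv ℝ Φ x (J x v) 0 = 0 ∧ fderiv ℝ Φ x (J x v) 1 = 0) ∧
      (∀ x v, v ≠ 0 → fderiv ℝ Φ x v 2 = 0 → fderiv ℝ Φ x v 3 = 0 →
        0 < stdSymplecticForm (fderiv ℝ Φ x v) (fderiv ℝ Φ x (J x v))) ∧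
      (∀ x v, v ≠ 0 → fderiv ℝ Φ x v 0 = 0 → fderiv ℝ Φ x v 1 = 0 →
        0 < stdSymplecticForm (fderiv ℝ Φ x v) (fderiv ℝ Φ x (J x v))) ∧
      Tendsto (fun x => ‖fderiv ℝ Φ x - ContinuousLinearMap.id ℝ (EuclideanSpace ℝ (Fin 4))‖)
        (cocompact (EuclideanSpace ℝ (Fin 4))) (𝓝 0) ∧
      (∃ C : ℝ, ∀ x, ‖Φ x - x‖ ≤ C) := by
  obtain ⟨Z, hZ⟩ := ChartOfAnchors.exists_clm_mk 0 1
  obtain ⟨W, hW⟩ := ChartOfAnchors.exists_clm_mk 2 3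
  obtain ⟨L, hL⟩ := ChartOfAnchors.exists_clm_chart
  have h1 : (∞ : WithTop ℕ∞) ≠ 0 := by simp
  -- the chart `Φ := fun y => L (c y, b y)` and its derivative
  have hd : ∀ x, HasFDerivAt (fun y => L (c y, b y))
      (L.comp ((fderiv ℝ c x).prod (fderiv ℝ b x))) x := fun x =>
    L.hasFDerivAt.comp x (((hc.differentiable h1) x).hasFDerivAt.prodMk
      ((hb.differentiable h1) x).hasFDerivAt)
  have hD : ∀ x v, fderiv ℝ (fun y => L (c y, b y)) x v =
      WithLp.toLp 2 ![(fderiv ℝ c x v).re, (fderiv ℝ c x v).im,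
        (fderiv ℝ b x v).re, (fderiv ℝ b x v).im] := by
    intro x v
    rw [(hd x).fderiv, ContinuousLinearMap.comp_apply, ContinuousLinearMap.prod_apply, hL]
  -- the two kernels in coordinates
  have hkb : ∀ x v, fderiv ℝ (fun y => L (c y, b y)) x v 2 = 0 →
      fderiv ℝ (fun y => L (c y, b y)) x v 3 = 0 → fderiv ℝ b x v = 0 := fun x v h2 h3 =>
    Complex.ext (by simpa [hD] using h2) (by simpa [hD] using h3)
  have hkc : ∀ x v, fderiv ℝ (fun y => L (c y, b y)) x v 0 = 0 →
      fderiv ℝ (fun y => L (c y, b y)) x v 1 = 0 → fderiv ℝ c x v = 0 := fun x v h0 h1' =>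
    Complex.ext (by simpa [hD] using h0) (by simpa [hD] using h1')
  -- positivity of the rotation numbers of `dc` and `db`, from the honest far point `x₀`
  have hR1 : R < |R| + 1 := by linarith [le_abs_self R]
  set x₀ : EuclideanSpace ℝ (Fin 4) := WithLp.toLp 2 ![|R| + 1, 0, |R| + 1, 0] with hx₀
  have hx₀n : R ≤ ‖x₀‖ := by
    refine le_trans ?_ (PiLp.norm_apply_le x₀ 0)
    have : x₀ 0 = |R| + 1 := by simp [hx₀]
    rw [this, Real.norm_eq_abs, abs_of_pos (by positivity)]
    exact hR1.le
  have hJx₀ := fun a => ChartOfAnchors.apply_of_inner_eq (hJi x₀ hx₀n) a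
  have hZx₀ : R < ‖Z x₀‖ := by
    have : Z x₀ = ((|R| + 1 : ℝ) : ℂ) := by rw [hZ]; apply Complex.ext <;> simp [hx₀]
    rw [this, Complex.norm_of_nonneg (by positivity)]; exact hR1
  have hWx₀ : R < ‖W x₀‖ := by
    have : W x₀ = ((|R| + 1 : ℝ) : ℂ) := by rw [hW]; apply Complex.ext <;> simp [hx₀]
    rw [this, Complex.norm_of_nonneg (by positivity)]; exact hR1
  have hposc : ∀ x v, fderiv ℝ c x v ≠ 0 → 0 < (fderiv ℝ c x v).re * (fderiv ℝ c x (J x v)).im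
      - (fderiv ℝ c x v).im * (fderiv ℝ c x (J x v)).re :=
    ChartOfAnchors.cross_pos_of_pos_at_point (fderiv ℝ c) J (hc.continuous_fderiv h1)
      hJs.continuous hJ2 hcs hcJ x₀ (fun v hv => ChartOfAnchors.cross_pos_at_far_point c Z 0 1
        hZ R hch (J x₀) (fun a => (hJx₀ a).1) (fun a => (hJx₀ a).2.1) x₀ hZx₀ v hv)
  have hposb : ∀ x v, fderiv ℝ b x v ≠ 0 → 0 < (fderiv ℝ b x v).re * (fderiv ℝ b x (J x v)).im
      - (fderiv ℝ b x v).im * (fderiv ℝ b x (J x v)).re :=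
    ChartOfAnchors.cross_pos_of_pos_at_point (fderiv ℝ b) J (hb.continuous_fderiv h1)
      hJs.continuous hJ2 hbs hbJ x₀ (fun v hv => ChartOfAnchors.cross_pos_at_far_point b W 2 3
        hW R hbh (J x₀) (fun a => (hJx₀ a).2.2.1) (fun a => (hJx₀ a).2.2.2) x₀ hWx₀ v hv)
  refine ⟨fun y => L (c y, b y), L.contDiff.comp (hc.prodMk hb), ?_, ?_, ?_, ?_, ?_, ?_, ?_⟩
  · -- bijective derivative: injective by transversality, then dimension count
    intro x
    have hinj : Function.Injective (fderiv ℝ (fun y => L (c y, b y)) x) := by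
      rw [injective_iff_map_eq_zero]
      intro v hv
      exact htr x v (hkb x v (by rw [hv]; rfl) (by rw [hv]; rfl))
        (hkc x v (by rw [hv]; rfl) (by rw [hv]; rfl))
    exact ⟨hinj, LinearMap.injective_iff_surjective.1 hinj⟩
  · -- `ker db` is `J`-invariant
    intro x v h2 h3
    have hb0 := hbJ x v (hkb x v h2 h3)
    constructor <;> simp [hD, hb0]
  · -- `ker dc` is `J`-invariant
    intro x v h0 h1'
    have hc0 := hcJ x v (hkc x v h0 h1')
    constructor <;> simp [hD, hc0]
  · -- positivity on `ker db`: the rotation number of `dc`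
    intro x v hv h2 h3
    have hb0 := hkb x v h2 h3
    rw [hD, hD, ChartOfAnchors.stdSymplecticForm_toLp, hb0, hbJ x v hb0]
    simpa using hposc x v fun h => hv (htr x v hb0 h)
  · -- positivity on `ker dc`: the rotation number of `db`
    intro x v hv h0 h1'
    have hc0 := hkc x v h0 h1'
    rw [hD, hD, ChartOfAnchors.stdSymplecticForm_toLp, hc0, hcJ x v hc0]
    simpa using hposb x v fun h => hv (htr x v h hc0)
  · -- `‖DΦ - id‖ ≤ ‖d(c - z)‖ + ‖d(b - w)‖ → 0` at infinity
    have hbound : ∀ x, ‖fderiv ℝ (fun y => L (c y, b y)) x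
        - ContinuousLinearMap.id ℝ (EuclideanSpace ℝ (Fin 4))‖
        ≤ ‖fderiv ℝ c x - Z‖ + ‖fderiv ℝ b x - W‖ := by
      intro x
      refine ContinuousLinearMap.opNorm_le_bound _ (by positivity) fun v => ?_
      rw [sub_apply, ContinuousLinearMap.id_apply, hD]
      calc ‖(WithLp.toLp 2 ![(fderiv ℝ c x v).re, (fderiv ℝ c x v).im, (fderiv ℝ b x v).re,
              (fderiv ℝ b x v).im] : EuclideanSpace ℝ (Fin 4)) - v‖
          ≤ ‖fderiv ℝ c x v - Complex.mk (v 0) (v 1)‖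
              + ‖fderiv ℝ b x v - Complex.mk (v 2) (v 3)‖ :=
            ChartOfAnchors.norm_toLp_sub_le _ _ v
        _ = ‖(fderiv ℝ c x - Z) v‖ + ‖(fderiv ℝ b x - W) v‖ := by
            rw [sub_apply, sub_apply, hZ, hW]
        _ ≤ ‖fderiv ℝ c x - Z‖ * ‖v‖ + ‖fderiv ℝ b x - W‖ * ‖v‖ :=
            add_le_add (ContinuousLinearMap.le_opNorm _ _) (ContinuousLinearMap.le_opNorm _ _)
        _ = (‖fderiv ℝ c x - Z‖ + ‖fderiv ℝ b x - W‖) * ‖v‖ := by ring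
    refine squeeze_zero (fun x => norm_nonneg _) hbound ?_
    simp only [ChartOfAnchors.fderiv_sub_mk (hc.differentiable h1) Z 0 1 hZ] at hcD
    simp only [ChartOfAnchors.fderiv_sub_mk (hb.differentiable h1) W 2 3 hW] at hbD
    simpa using hcD.add hbD
  · -- `Φ - id` is bounded
    obtain ⟨C, hC⟩ := hC
    refine ⟨C + C, fun x => ?_⟩
    calc ‖L (c x, b x) - x‖
        ≤ ‖c x - Complex.mk (x 0) (x 1)‖ + ‖b x - Complex.mk (x 2) (x 3)‖ := by
          rw [hL]; exact ChartOfAnchors.norm_toLp_sub_le _ _ x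
      _ ≤ C + C := add_le_add (hC x).2 (hC x).1

end Summit.SmoothPoincare4.SmoothPoincare4.Cruxes.TameOrBrodyR4.Sketch
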